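import Summits.HodgeConjecture.HodgeConjecture.Theorems.WeilTypeLadderTwistLefschetzLinearAlgebra
import Summits.HodgeConjecture.HodgeConjecture.Theorems.WeilTypeLadderTwistLefschetzPairing
import Summits.HodgeConjecture.HodgeConjecture.Theorems.WeilTypeLadderTwistDecomposableInstances
import Literature.AlgebraicGeometry.Milne1999.SpecialLefschetzGroupInvariantsHolds
import Literature.AlgebraicGeometry.HodgeTheory.HodgeGroupExteriorAction
import HarnessLib

/-!
# Weil-type ladder — THEOREM EXC (iii) IN EVERY RANK AND LEVEL: the `K′`-Weil classes of a twisted `ℚ(ζ_m)`-module are LEFSCHETZ CLASSES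

b2b cell `hweil` (packet `run/shared/lean/b2b/hodge-weil/`), prover 3, report `b2b-hweil-pv3-g48/TWIST-LEFSCHETZ.md` §§1–4
(generalising `Theorems/WeilTypeLadderTwistDecomposable`, the case `r = 2`, `φ(m) = 8` of pv3-g47, by a different route).

SETTING (all binders explicit). `B` a complex abelian variety; `s : B ⟶ B` with `Φ_m(s) = 0` and `φ(m)·r = 2 dim B` — so
`H¹(B(ℂ); ℂ) = ⊕_c V_c` over the primitive `m`-th roots `c`, each `V_c` of dimension `r` (an `E = ℚ(ζ_m)`-module of rank
`r`); a TWISTING endomorphism `τ` with a left inverse `τ'`, `τ ≫ s = s^u ≫ τ`, `u² ≡ 1`, `u ≢ −1 (mod m)`; `θ = Q(s)` with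
`Q(c̄^u) = Q(c)` on the roots (so `θ` lies in the CM subfield `K′ = E^{⟨ιu⟩}` of index `2`), `P` monic irreducible of degree
`e` with `P(θ) = 0` and `e·(2r) = 2 dim B` (so `weilClassesField B θ P (2r) = W_{K′} ⊗ ℂ = ⊕_ρ ⋀^{2r} V_ρ(θ)`,
Moonen–Zarhin, each summand a LINE).

* `weilClassesField_le_divisorClassesSpan_of_twist_rank` — **`W_{K′} ⊗ ℂ ⊆ Dʳ(B) ⊗ ℂ`**: every `K′`-Weil class is a
  polynomial in divisor classes; corollary `weilClassesField_le_algebraicClasses_of_twist_rank` — ALGEBRAIC. No named fact,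
  no polarization binder, every rank `r`, every level `m`.

PROOF (new route; report §1). Milne 1999, Cor. 4.5 / Thm. 3.2 is a THEOREM of the tree on these carriers
(`Milne1999.mem_divisorClassesSpan_of_forall_mem_unitaryCentralizerGroup`): a class of `H^{2r}(B(ℂ); ℂ)` fixed by `⋀^{2r}u`
for every `u ∈ S(B)(ℂ) = unitaryCentralizerGroup B h` — the automorphisms of `H¹` commuting with every `φ^*`, `φ ∈ End B`,
and preserving Milne's pairing `Q_h(x,y) = h^{dim B−1} ⌣ x ⌣ y` of a class `h ∈ B¹(B) ⊗ ℂ` with `Q_h` non-degenerate — lies in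
`Dʳ ⊗ ℂ`. Take for `h` an `s`-INVARIANT rational Kähler class (`exists_invariant_rational_kaehlerClass`: orbit sum of a
Kähler–rational datum); then `Q_h` is `s^*`-invariant (`polarizationPairingOne_map_map_of_map_eq`), hence pairs `V_c` with
`V_{c̄}` only, perfectly. For `u ∈ S(B)(ℂ)`: `u` commutes with `s^*`, `τ^*`, `θ^*`, so preserves every `V_c`; on the line
`⋀^{2r}(V_c ⊕ V_μ) ⊆ ⋀^{2r}V_ρ(θ)` (`ρ = Q(c)`, `μ = c̄^u ≠ c`, `dim V_c = dim V_μ = r`) the operator `⋀^{2r}u` acts by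
`det(u|V_c ⊕ V_μ) = det(u|V_c)·det(u|V_μ)` (`det_restrict_sup_eq_mul`), and this is `1` because the pairing
`(x, y) ↦ Q_h(x, τ^*y)` between `V_c` and `V_μ` is PERFECT (`τ^* V_μ = V_{μ^u} = V_{c̄}`) and `u`-invariant
(`det_restrict_mul_det_restrict_eq_one_of_pairing`). So `⋀^{2r}u` fixes `W_{K′} ⊗ ℂ` pointwise and Milne's theorem applies.

HONEST LABEL: as for pv3-g47 — DECOMPOSABLE classes on the twisted locus (End ⊋ E); R3's conclusion there with no named fact;
NOT a rung, NOT evidence about exceptional classes; 0 unconditional rungs above the floor; Markman-free; no `sorry`, no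
definition, no named fact. [cite: Milne1999LefschetzClasses, Cor. 4.5, Thm. 4.4, Thm. 3.2 (pp. 653–659)]
[cite: Rohde2009CyclicCoverings, Ch. 6 §6.4] [cite: MoonenZarhin1998WeilClasses, §1] [cite: Deligne1982HodgeCycles, §4 (4.4)]
-/

noncomputable section

-- every declaration of this problem lives in `Summit.HodgeConjecture.HodgeConjecture.…` (summit = sub-problem)
set_option linter.dupNamespace false

open CategoryTheory Polynomial
open Literature.AlgebraicGeometry Literature.AlgebraicGeometry.Motives
open Literature.AlgebraicGeometry.HodgeTheory
open Literature.AlgebraicTopology.SingularHomology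
open Literature.AlgebraicGeometry.Milne1999
open Literature.Barriers.HodgeConjecture (divisorClassesSpan)

namespace Summit.HodgeConjecture.HodgeConjecture.WeilTypeLadder

/-- **THEOREM EXC (iii) in every rank and level (kernel form): for a twisted `ℚ(ζ_m)`-module the `K′`-Weil classes are
divisor polynomials.** See the module docstring for the setting and the proof (Milne's special Lefschetz group fixes
`W_{K′} ⊗ ℂ` pointwise). [cite: Milne1999LefschetzClasses, Cor. 4.5 and Thm. 3.2] [cite: Rohde2009CyclicCoverings, Ch. 6 §6.4]
[cite: MoonenZarhin1998WeilClasses, §1] -/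
theorem weilClassesField_le_divisorClassesSpan_of_twist_rank
    (B : AbelianVariety ℂ) (s τ τ' : B ⟶ B) (m u r e : ℕ) (Q P : Polynomial ℤ)
    (hmr : Nat.totient m * r = 2 * B.dim)
    (hs : Polynomial.eval₂ (Int.castRingHom (CategoryTheory.End B)) (CategoryTheory.End.of s)
      (Polynomial.cyclotomic m ℤ) = 0)
    (hτ : τ ≫ s = CategoryTheory.End.asHom (CategoryTheory.End.of s ^ u) ≫ τ) (hτ' : τ' ≫ τ = 𝟙 B)
    (hu : u * u ≡ 1 [MOD m]) (hu1 : ¬ m ∣ u + 1)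
    (hQ : ∀ c : ℂ, Polynomial.eval₂ (Int.castRingHom ℂ) c (Polynomial.cyclotomic m ℤ) = 0 →
      Polynomial.eval₂ (Int.castRingHom ℂ) (starRingEnd ℂ c ^ u) Q = Polynomial.eval₂ (Int.castRingHom ℂ) c Q)
    (hPm : P.Monic) (hPe : P.natDegree = e) (hPirr : Irreducible (P.map (Int.castRingHom ℚ)))
    (hPθ : Polynomial.eval₂ (Int.castRingHom (CategoryTheory.End B))
      ((CategoryTheory.End.asHom (Polynomial.eval₂ (Int.castRingHom (CategoryTheory.End B))
        (CategoryTheory.End.of s) Q) : B ⟶ B) : CategoryTheory.End B) P = 0)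
    (her : e * (2 * r) = 2 * B.dim) :
    weilClassesField B (CategoryTheory.End.asHom (Polynomial.eval₂ (Int.castRingHom (CategoryTheory.End B))
        (CategoryTheory.End.of s) Q)) P (2 * r) ≤ divisorClassesSpan B.X B.dim r := by
  classical
  /- (0) the trivial degrees: `r = 0`, or `dim B < r` -/
  rcases Nat.eq_zero_or_pos r with hr0 | hr
  · exact fun x _ => mem_divisorClassesSpan_of_eq_zero_or_lt B (Or.inl hr0) x
  by_cases hrB : B.dim < r
  · exact fun x _ => mem_divisorClassesSpan_of_eq_zero_or_lt B (Or.inr hrB) x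
  have hBdim : 0 < B.dim := lt_of_lt_of_le hr (not_lt.1 hrB)
  have hX : IsSmoothProjective B.dim B.X := AbelianVariety.isSmoothProjective_holds (A := B)
  haveI := finite_complexBetti_abelianVariety B 1
  have hΛ := AbelianVariety.hasExteriorCohomologyH1_complexPoints B
  set θ : B ⟶ B := CategoryTheory.End.asHom (Polynomial.eval₂ (Int.castRingHom (CategoryTheory.End B))
    (CategoryTheory.End.of s) Q) with hθdef
  set T : Module.End ℂ (complexBetti B.X 1) := (complexBetti.map s.hom.hom.hom 1).hom with hTdef
  set Θ : Module.End ℂ (complexBetti B.X 1) := (complexBetti.map θ.hom.hom.hom 1).hom with hΘdef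
  set U : Module.End ℂ (complexBetti B.X 1) := (complexBetti.map τ.hom.hom.hom 1).hom with hUdef
  set QC : Polynomial ℂ := Q.map (Int.castRingHom ℂ) with hQCdef
  /- (1) arithmetic of `m`, `Φ_m`, its roots, `s^m = 1` (as in `…TwistDecomposable`) -/
  have hm0 : 0 < m := by
    rcases Nat.eq_zero_or_pos m with h | h
    · exfalso; subst h; rw [Nat.totient_zero, zero_mul] at hmr; omega
    · exact h
  have hm2 : 2 ≤ m := by
    by_contra h
    have hm1 : m = 1 := by omega
    exact hu1 (by rw [hm1]; exact one_dvd _)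
  have hΦm : (Polynomial.cyclotomic m ℤ).Monic := Polynomial.cyclotomic.monic m ℤ
  have hΦe : (Polynomial.cyclotomic m ℤ).natDegree = Nat.totient m := Polynomial.natDegree_cyclotomic m ℤ
  have hΦirr : Irreducible ((Polynomial.cyclotomic m ℤ).map (Int.castRingHom ℚ)) := by
    rw [Polynomial.map_cyclotomic_int]; exact Polynomial.cyclotomic.irreducible_rat hm0
  have hroot : ∀ c : ℂ, Polynomial.eval₂ (Int.castRingHom ℂ) c (Polynomial.cyclotomic m ℤ) = 0 →
      IsPrimitiveRoot c m := fun c hc => isPrimitiveRoot_of_eval₂_cyclotomic hm0.ne' hc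
  have hroot' : ∀ c : ℂ, IsPrimitiveRoot c m →
      Polynomial.eval₂ (Int.castRingHom ℂ) c (Polynomial.cyclotomic m ℤ) = 0 := by
    intro c hc
    haveI : NeZero (m : ℂ) := ⟨Nat.cast_ne_zero.2 hm0.ne'⟩
    rw [Polynomial.eval₂_eq_eval_map, Polynomial.map_cyclotomic_int]
    exact Polynomial.isRoot_cyclotomic_iff.2 hc
  have hQCeval : ∀ c : ℂ, QC.eval c = Polynomial.eval₂ (Int.castRingHom ℂ) c Q := fun c => Polynomial.eval_map _ _
  have hsm : CategoryTheory.End.of s ^ m = 1 := pow_eq_one_of_eval₂_cyclotomic _ hs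
  have hTm : T ^ m = 1 := by
    rw [hTdef, ← hom_complexBetti_map_pow_one s m, hsm]
    ext c
    exact abelianVariety_map_id_apply (A := B) c
  have hUT : ∀ x, U (T x) = (T ^ u) (U x) := by
    intro x
    rw [hTdef, ← hom_complexBetti_map_pow_one s u, hUdef]
    change singularCohomology.map ℂ ℂ (Motives.AlgPoints.mapContinuous (L := ℂ) τ.hom.hom.hom) 1
        (singularCohomology.map ℂ ℂ (Motives.AlgPoints.mapContinuous (L := ℂ) s.hom.hom.hom) 1 x) =
      singularCohomology.map ℂ ℂ (Motives.AlgPoints.mapContinuous (L := ℂ)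
          (CategoryTheory.End.asHom (CategoryTheory.End.of s ^ u)).hom.hom.hom) 1
        (singularCohomology.map ℂ ℂ (Motives.AlgPoints.mapContinuous (L := ℂ) τ.hom.hom.hom) 1 x)
    rw [abelianVariety_map_map_apply, abelianVariety_map_map_apply, hτ]
  have hUinj : Function.Injective U := by
    intro x y hxy
    have h := congrArg (singularCohomology.map ℂ ℂ (Motives.AlgPoints.mapContinuous (L := ℂ) τ'.hom.hom.hom) 1) hxy
    change singularCohomology.map ℂ ℂ (Motives.AlgPoints.mapContinuous (L := ℂ) τ'.hom.hom.hom) 1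
        (singularCohomology.map ℂ ℂ (Motives.AlgPoints.mapContinuous (L := ℂ) τ.hom.hom.hom) 1 x) =
      singularCohomology.map ℂ ℂ (Motives.AlgPoints.mapContinuous (L := ℂ) τ'.hom.hom.hom) 1
        (singularCohomology.map ℂ ℂ (Motives.AlgPoints.mapContinuous (L := ℂ) τ.hom.hom.hom) 1 y) at h
    rwa [abelianVariety_map_map_apply, abelianVariety_map_map_apply, hτ', abelianVariety_map_id_apply,
      abelianVariety_map_id_apply] at h
  have hUbij : Function.Bijective U := ⟨hUinj, LinearMap.surjective_of_injective hUinj⟩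
  have hΘ : Θ = Polynomial.aeval T QC := hom_complexBetti_map_eval₂_one s Q
  /- (2) the `s`-invariant rational Kähler class `h`, Milne's form `Q_h`, its scalar form `Bf` -/
  obtain ⟨h, hQh, hKh, hsh⟩ := exists_invariant_rational_kaehlerClass B s hm0 hsm
  have hK1 : IsKaehlerClass B.dim B.X (((1 : ℝ) : ℂ) • h) := by rwa [Complex.ofReal_one, one_smul]
  have hnd := eq_zero_of_forall_polarizationPairingOne_eq_zero_of_isKaehlerClass_smul' one_ne_zero hK1
  have hh : h ∈ VanGeemen1994.hodgeClassSpan B.dim B.X 1 := mem_hodgeClassSpan_one_of_isKaehlerClass_smul hQh one_ne_zero hK1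
  obtain ⟨Bf, hBalt, hBnd, -, hBiff⟩ := exists_hodgeInvariant_bilinForm hh hnd
  -- `s^*` as an automorphism of `H¹`, and the `s^*`-invariance of `Bf`
  have hTinj : Function.Injective T := by
    intro x y hxy
    have key : ∀ z, (T ^ (m - 1)) (T z) = z := fun z => by
      rw [← Module.End.mul_apply, ← pow_succ, Nat.sub_add_cancel hm0, hTm, Module.End.one_apply]
    rw [← key x, ← key y, hxy]
  let Te : complexBetti B.X 1 ≃ₗ[ℂ] complexBetti B.X 1 :=
    LinearEquiv.ofBijective T ⟨hTinj, LinearMap.surjective_of_injective hTinj⟩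
  have hTe : ∀ x, Te x = T x := fun x => rfl
  have hBT : ∀ x y, Bf (T x) (T y) = Bf x y := by
    have h1 := (hBiff Te).1 (fun v w => by
      rw [hTe, hTe]; exact polarizationPairingOne_map_map_of_map_eq B s hKh hBdim hsh v w)
    intro x y
    rw [← hTe, ← hTe]
    exact h1 x y
  /- (3) eigen-structure of `s^*` on `H¹` -/
  obtain ⟨N, b, lam, hlamΦ, hbmem⟩ := exists_eigenbasis_complexBetti_one (A := B) (φ := s) hΦirr hs
  have hb : ∀ j, T (b j) = lam j • b j := fun j => Module.End.mem_eigenspace_iff.1 (hbmem j)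
  have hfinrank : ∀ c : ℂ, Polynomial.eval₂ (Int.castRingHom ℂ) c (Polynomial.cyclotomic m ℤ) = 0 →
      Module.finrank ℂ (Module.End.eigenspace T c) = r := fun c hc =>
    finrank_eigenspace_eq_of_root hΦm hΦe hΦirr hs (by rw [hmr]) hc
  have hΘb : ∀ j, Θ (b j) = QC.eval (lam j) • b j := fun j => by
    rw [hΘ]; exact aeval_apply_of_eq_smul T QC (hb j)
  /- (4) reduce to one summand `⋀^{2r} V_ρ(θ)` and one `u ∈ S(B)(ℂ)` -/
  intro x hx
  refine mem_divisorClassesSpan_of_forall_mem_unitaryCentralizerGroup B hh hnd r x fun uu huu => ?_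
  obtain ⟨hcen, hBu⟩ := (mem_unitaryCentralizerGroup_iff_of_bilinForm hBiff uu).1 huu
  set uL : complexBetti B.X 1 →ₗ[ℂ] complexBetti B.X 1 := (uu : complexBetti B.X 1 →ₗ[ℂ] complexBetti B.X 1) with huL
  have hBuL : ∀ v w, Bf (uL v) (uL w) = Bf v w := fun v w => hBu v w
  have huT : ∀ z, uL (T z) = T (uL z) := fun z => mem_centralizerGroup_iff.1 hcen s z
  have huU : ∀ z, uL (U z) = U (uL z) := fun z => mem_centralizerGroup_iff.1 hcen τ z
  have hupres : ∀ c : ℂ, ∀ z ∈ Module.End.eigenspace T c, uL z ∈ Module.End.eigenspace T c := by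
    intro c z hz
    rw [Module.End.mem_eigenspace_iff] at hz ⊢
    rw [← huT, hz, map_smul]
  suffices hle : weilClassesField B θ P (2 * r) ≤
      LinearMap.eqLocus (exteriorPullback hΛ uL (2 * r)) LinearMap.id from hle hx
  refine iSup₂_le fun ρ hρ => ?_
  change Polynomial.eval₂ (Int.castRingHom ℂ) ρ P = 0 at hρ
  obtain ⟨ω, -, -, -, hωgen⟩ :=
    exists_generator_pullbackEigenclasses_of_root (A := B) (φ := θ) (r := 2 * r) hPm hPe hPirr hPθ her hρ
  /- (5) a primitive root `c` with `Q(c) = ρ`, its partner `μ = c̄^u ≠ c` -/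
  set J : Finset (Fin N) := Finset.univ.filter fun j => QC.eval (lam j) = ρ with hJdef
  have hJcard : J.card = 2 * r := by
    rw [hJdef, ← finrank_eigenspace_eq_card b Θ (fun j => QC.eval (lam j)) hΘb ρ]
    exact finrank_eigenspace_eq_of_root hPm hPe hPirr hPθ her hρ
  obtain ⟨j₀, hj₀⟩ : J.Nonempty := by rw [← Finset.card_pos, hJcard]; omega
  obtain ⟨c, hcdef⟩ : ∃ c : ℂ, c = lam j₀ := ⟨_, rfl⟩
  have hcρ : QC.eval c = ρ := by rw [hcdef]; exact (Finset.mem_filter.1 hj₀).2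
  have hcprim : IsPrimitiveRoot c m := by rw [hcdef]; exact hroot _ (hlamΦ j₀)
  have hcΦ : Polynomial.eval₂ (Int.castRingHom ℂ) c (Polynomial.cyclotomic m ℤ) = 0 := hroot' c hcprim
  obtain ⟨hc0, hcinv, -⟩ := conj_eq_pow_of_isPrimitiveRoot hm0 hcprim
  have hcc : c * starRingEnd ℂ c = 1 := by rw [hcinv, mul_inv_cancel₀ hc0]
  have hcbar_pow : starRingEnd ℂ c ^ m = 1 := by rw [← map_pow, hcprim.pow_eq_one, map_one]
  obtain ⟨μ, hμdef⟩ : ∃ μ : ℂ, μ = starRingEnd ℂ c ^ u := ⟨_, rfl⟩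
  obtain ⟨-, hμprim⟩ := conj_pow_conj_pow hm2 hu hcprim
  rw [← hμdef] at hμprim
  have hμΦ : Polynomial.eval₂ (Int.castRingHom ℂ) μ (Polynomial.cyclotomic m ℤ) = 0 := hroot' μ hμprim
  have hμρ : QC.eval μ = ρ := by rw [hμdef, hQCeval, hQ _ hcΦ, ← hQCeval]; exact hcρ
  have hμc : μ ≠ c := by
    intro hμc'
    apply hu1
    rw [← hcprim.pow_eq_one_iff_dvd]
    calc c ^ (u + 1) = c ^ u * c := pow_succ c u
      _ = c ^ u * starRingEnd ℂ c ^ u := by rw [← hμdef, hμc']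
      _ = (c * starRingEnd ℂ c) ^ u := (mul_pow _ _ _).symm
      _ = 1 := by rw [hcc, one_pow]
  have hμu : μ ^ u = starRingEnd ℂ c := by
    obtain ⟨k, hk⟩ := exists_mul_self_eq_of_modEq hm2 hu
    rw [hμdef, ← pow_mul, hk, pow_add, pow_mul, hcbar_pow, one_pow, one_mul, pow_one]
  /- (6) the subspaces `V_c`, `V_μ`, their sum `W`, all inside `V_ρ(θ)` -/
  set Vc : Submodule ℂ (complexBetti B.X 1) := Module.End.eigenspace T c with hVcdef
  set Vμ : Submodule ℂ (complexBetti B.X 1) := Module.End.eigenspace T μ with hVμdef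
  set Vcb : Submodule ℂ (complexBetti B.X 1) := Module.End.eigenspace T (starRingEnd ℂ c) with hVcbdef
  have hVc_r : Module.finrank ℂ Vc = r := hfinrank c hcΦ
  have hVμ_r : Module.finrank ℂ Vμ = r := hfinrank μ hμΦ
  have hVcb_r : Module.finrank ℂ Vcb = r :=
    hfinrank _ (hroot' _ (by rw [hcinv]; exact hcprim.inv))
  have hdis : Disjoint Vc Vμ := by
    rw [Submodule.disjoint_def]
    intro z hzc hzμ
    rw [hVcdef, Module.End.mem_eigenspace_iff] at hzc
    rw [hVμdef, Module.End.mem_eigenspace_iff] at hzμ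
    have hz : (c - μ) • z = 0 := by rw [sub_smul, ← hzc, ← hzμ, sub_self]
    exact (smul_eq_zero.1 hz).resolve_left (sub_ne_zero.2 hμc.symm)
  have hle : ∀ (ν : ℂ), QC.eval ν = ρ → Module.End.eigenspace T ν ≤ Module.End.eigenspace Θ ρ := by
    intro ν hν z hz
    rw [Module.End.mem_eigenspace_iff] at hz ⊢
    rw [hΘ, aeval_apply_of_eq_smul T QC hz, hν]
  have hWle : Vc ⊔ Vμ ≤ Module.End.eigenspace Θ ρ := sup_le (hle c hcρ) (hle μ hμρ)
  have hW_r : Module.finrank ℂ ↥(Vc ⊔ Vμ) = 2 * r := by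
    have h1 := Submodule.finrank_sup_add_finrank_inf_eq Vc Vμ
    rw [hdis.eq_bot, finrank_bot, add_zero, hVc_r, hVμ_r] at h1
    omega
  -- `τ^*` maps `V_μ` ONTO `V_{c̄}`
  have hUμ : ∀ z ∈ Vμ, U z ∈ Vcb := by
    intro z hz
    have h1 := apply_mem_eigenspace_pow_of_twist T U hm2 hu hTm hUT hz
    rwa [hμu] at h1
  have hUonto : ∀ z ∈ Vcb, ∃ y ∈ Vμ, U y = z := by
    let Ue : complexBetti B.X 1 ≃ₗ[ℂ] complexBetti B.X 1 := LinearEquiv.ofBijective U hUbij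
    have hmap : Vμ.map (Ue : complexBetti B.X 1 →ₗ[ℂ] complexBetti B.X 1) = Vcb := by
      apply Submodule.eq_of_le_of_finrank_eq
      · rintro _ ⟨y, hy, rfl⟩; exact hUμ y hy
      · rw [LinearEquiv.finrank_map_eq, hVμ_r, hVcb_r]
    intro z hz
    rw [← hmap, Submodule.mem_map] at hz
    obtain ⟨y, hy, hyz⟩ := hz
    exact ⟨y, hy, hyz⟩
  /- (7) the determinants: `det(u|V_c) · det(u|V_μ) = 1` by the perfect `u`-invariant pairing `Bf(x, τ^* y)` -/
  have hdet1 : LinearMap.det (uL.restrict (hupres c)) * LinearMap.det (uL.restrict (hupres μ)) = 1 := by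
    refine det_restrict_mul_det_restrict_eq_one_of_pairing Vc Vμ (Bf.compl₂ U) uL (hupres c) (hupres μ)
      ?_ ?_ ?_
    · -- left non-degeneracy
      intro z hz h0
      refine eq_zero_of_form_eigenspace_eq_zero Bf hBnd T hBT b lam hbmem hcc hz fun w hw => ?_
      obtain ⟨y, hy, rfl⟩ := hUonto w hw
      have := h0 y hy
      rwa [LinearMap.compl₂_apply] at this
    · -- right non-degeneracy
      intro y hy h0
      have hUy : U y ∈ Vcb := hUμ y hy
      have hUy0 : U y = 0 :=
        eq_zero_of_form_eigenspace_eq_zero_right Bf hBnd hBalt T hBT b lam hbmem hcc hUy fun z hz => by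
          have := h0 z hz
          rwa [LinearMap.compl₂_apply] at this
      exact hUinj (by rw [hUy0, map_zero])
    · -- invariance
      intro z _ y _
      rw [LinearMap.compl₂_apply, LinearMap.compl₂_apply, ← huU, hBuL]
  have hdetW : LinearMap.det (uL.restrict (mapsTo_sup_of_mapsTo (hupres c) (hupres μ))) = 1 := by
    rw [det_restrict_sup_eq_mul Vc Vμ hdis uL (hupres c) (hupres μ), hdet1]
  /- (8) the explicit generator `ω' = w₁ ⌣ ⋯ ⌣ w_{2r}` of the line `⋀^{2r} V_ρ(θ)` is fixed by `⋀u` -/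
  let w := Module.finBasisOfFinrankEq ℂ (↥(Vc ⊔ Vμ)) hW_r
  let wv : Fin (2 * r) → complexBetti B.X 1 := fun i => (w i : complexBetti B.X 1)
  have hwv : ∀ i, wv i ∈ Module.End.eigenspace Θ ρ := fun i => hWle (w i).2
  have hwvli : LinearIndependent ℂ wv := w.linearIndependent.map' (Vc ⊔ Vμ).subtype (Submodule.ker_subtype _)
  set ω' := cupPowOne ℂ (Motives.ComplexPoints B.X) (2 * r) wv with hω'def
  have hω'0 : ω' ≠ 0 := cupPowOne_ne_zero_of_linearIndependent B hwvli
  have hω'L : ω' ∈ pullbackEigenclasses B θ (2 * r) (fun x y => ((x : ℂ) + (y : ℂ) * ρ) ^ (2 * r)) :=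
    mem_pullbackEigenclasses_iff.2 fun x y => map_cupPowOne_of_mem_eigenspace hwv x y
  have hfixω' : exteriorPullback hΛ uL (2 * r) ω' = ω' := by
    rw [hω'def, exteriorPullback_cupPowOne, ← cupPowOneAlt_apply, ← cupPowOneAlt_apply]
    have h := alternatingMap_apply_restrict_eq_det_smul (cupPowOneAlt ℂ (Motives.ComplexPoints B.X) (2 * r)) w uL
      (mapsTo_sup_of_mapsTo (hupres c) (hupres μ))
    rw [hdetW, one_smul] at h
    exact h
  /- (9) every class of the line is a multiple of `ω'` -/
  intro z hz
  rw [LinearMap.mem_eqLocus, LinearMap.id_apply]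
  obtain ⟨t, rfl⟩ := hωgen z hz
  obtain ⟨t', ht'⟩ := hωgen ω' hω'L
  have ht'0 : t' ≠ 0 := by rintro rfl; rw [zero_smul] at ht'; exact hω'0 ht'
  have hω : ω = t'⁻¹ • ω' := by rw [ht', smul_smul, inv_mul_cancel₀ ht'0, one_smul]
  rw [hω, map_smul, map_smul, hfixω']

/-- **Corollary: the `K′`-Weil classes of a twisted `ℚ(ζ_m)`-module are ALGEBRAIC**, in every rank and level — divisor
polynomials are algebraic on an abelian variety (Lefschetz `(1,1)` + products; tree theorems). No named fact.
[cite: Milne1999LefschetzClasses, Cor. 4.5] [cite: VoisinHodgeI2002, Thm. 11.30] [cite: Rohde2009CyclicCoverings, Ch. 6 §6.4] -/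
theorem weilClassesField_le_algebraicClasses_of_twist_rank
    (B : AbelianVariety ℂ) (s τ τ' : B ⟶ B) (m u r e : ℕ) (Q P : Polynomial ℤ)
    (hmr : Nat.totient m * r = 2 * B.dim)
    (hs : Polynomial.eval₂ (Int.castRingHom (CategoryTheory.End B)) (CategoryTheory.End.of s)
      (Polynomial.cyclotomic m ℤ) = 0)
    (hτ : τ ≫ s = CategoryTheory.End.asHom (CategoryTheory.End.of s ^ u) ≫ τ) (hτ' : τ' ≫ τ = 𝟙 B)
    (hu : u * u ≡ 1 [MOD m]) (hu1 : ¬ m ∣ u + 1)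
    (hQ : ∀ c : ℂ, Polynomial.eval₂ (Int.castRingHom ℂ) c (Polynomial.cyclotomic m ℤ) = 0 →
      Polynomial.eval₂ (Int.castRingHom ℂ) (starRingEnd ℂ c ^ u) Q = Polynomial.eval₂ (Int.castRingHom ℂ) c Q)
    (hPm : P.Monic) (hPe : P.natDegree = e) (hPirr : Irreducible (P.map (Int.castRingHom ℚ)))
    (hPθ : Polynomial.eval₂ (Int.castRingHom (CategoryTheory.End B))
      ((CategoryTheory.End.asHom (Polynomial.eval₂ (Int.castRingHom (CategoryTheory.End B))
        (CategoryTheory.End.of s) Q) : B ⟶ B) : CategoryTheory.End B) P = 0)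
    (her : e * (2 * r) = 2 * B.dim) :
    weilClassesField B (CategoryTheory.End.asHom (Polynomial.eval₂ (Int.castRingHom (CategoryTheory.End B))
        (CategoryTheory.End.of s) Q)) P (2 * r) ≤ algebraicClasses B.X r :=
  (weilClassesField_le_divisorClassesSpan_of_twist_rank B s τ τ' m u r e Q P hmr hs hτ hτ' hu hu1 hQ hPm hPe hPirr hPθ
    her).trans (AbelianVariety.divisorClassesSpan_le_algebraicClasses B
      (fun b hb hb' => lefschetzOneOne_rational_holds (AbelianVariety.isSmoothProjective_holds (A := B)) b hb hb') r)

/-- **pv3-g47's THEOREM EXC (iii) is the case `r = 2`, `φ(m) = 8`** (abelian eightfolds, quartic `K′`, classes in `H⁴`):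
the `ψ`-free statement of `weilClassesField_le_algebraicClasses_of_twist'` re-derived from the rank form.
[cite: Rohde2009CyclicCoverings, Ch. 6 §6.4] -/
example (B : AbelianVariety ℂ) (s τ τ' : B ⟶ B) (m u : ℕ) (Q P : Polynomial ℤ)
    (hm8 : Nat.totient m = 8) (hdim : B.dim = 8)
    (hs : Polynomial.eval₂ (Int.castRingHom (CategoryTheory.End B)) (CategoryTheory.End.of s)
      (Polynomial.cyclotomic m ℤ) = 0)
    (hτ : τ ≫ s = CategoryTheory.End.asHom (CategoryTheory.End.of s ^ u) ≫ τ) (hτ' : τ' ≫ τ = 𝟙 B)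
    (hu : u * u ≡ 1 [MOD m]) (hu1 : ¬ m ∣ u + 1)
    (hQ : ∀ c : ℂ, Polynomial.eval₂ (Int.castRingHom ℂ) c (Polynomial.cyclotomic m ℤ) = 0 →
      Polynomial.eval₂ (Int.castRingHom ℂ) (starRingEnd ℂ c ^ u) Q = Polynomial.eval₂ (Int.castRingHom ℂ) c Q)
    (hPm : P.Monic) (hPe : P.natDegree = 4) (hPirr : Irreducible (P.map (Int.castRingHom ℚ)))
    (hPθ : Polynomial.eval₂ (Int.castRingHom (CategoryTheory.End B))
      ((CategoryTheory.End.asHom (Polynomial.eval₂ (Int.castRingHom (CategoryTheory.End B))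
        (CategoryTheory.End.of s) Q) : B ⟶ B) : CategoryTheory.End B) P = 0) :
    weilClassesField B (CategoryTheory.End.asHom (Polynomial.eval₂ (Int.castRingHom (CategoryTheory.End B))
        (CategoryTheory.End.of s) Q)) P 4 ≤ algebraicClasses B.X 2 :=
  weilClassesField_le_algebraicClasses_of_twist_rank B s τ τ' m u 2 4 Q P (by rw [hm8, hdim]) hs hτ hτ' hu hu1 hQ hPm hPe
    hPirr hPθ (by rw [hdim])

end Summit.HodgeConjecture.HodgeConjecture.WeilTypeLadder

end
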